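import Mathlib
import Literature.NumberTheory.LFunctions.Zhang2022.TypedSection12A
import Literature.NumberTheory.LFunctions.Zhang2022.Section12FraktSums
import Literature.NumberTheory.LFunctions.Zhang2022.Section11E2MeanSquare
import HarnessLib

/-!
# Zhang (2022) §12 (12.6): the deduction `Z22:(12.6)` reduced to ONE unprinted `S_j`-estimate

Topic `Literature/NumberTheory/LFunctions/Zhang2022` (Landau–Siegel audit tree; verdict-neutral).
Y. Zhang, *Discrete mean estimates and the Landau–Siegel zero*, arXiv:2211.02515v1 (2022)
[Zhang2022LandauSiegel], §12 pp. 66–67, tex L3394–L3423 — **an unrefereed manuscript under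
adjudication** (campaign D-0069). THEOREMS ONLY; no new fact, no `def`.

The manuscript proves (12.6) `ΣΣ𝔠*(ρ,ψ)|H₁₅(ρ,ψ) − H̃₁₅(ρ,ψ)|²ω(ρ) = o(𝔞𝔓)` by the sentence "These
bounds [the `ϰ₁₂ − ϰ₁` bounds, DAG u004–u006] together with (8.25) and (8.26) imply (12.6). We
briefly describe the argument as follows" + the two `𝔱`-sum displays (u007, u008) — (8.25)/(8.26) do
not exist in v1, and no mean-value computation for the coefficients `ϰ₁ − ϰ₁₂` is printed (typer
L3-t4's GAPCAND G·12a; the typed deduction node `Typed.Sec12A.Ded126` lists Lemma 8.1, Prop. 7.1,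
Prop. 2.2 (i) as the tacit inputs). Two kernel facts about that node:

* `ded126_vacuous` — **`Ded126 c′` AS TYPED holds vacuously**: its antecedent
  `Typed.Sec12A.FraktDoubleSum` (u008 as printed) is refuted in the tree
  (`Typed.Sec12A.not_fraktDoubleSum`, `Section12FraktSums`). Recorded so that nobody mistakes a
  proof of `Ded126` for a proof of (12.6); the node wants re-typing with `fraktDoubleSum_repaired`
  / `fraktDoubleSum_corrected` in place of `FraktDoubleSum`.
* `eq126_of_sj_small` — **what (12.6) really rests on**: writing `H₁₅ − H̃₁₅ = A(𝐛;s,ψ)` with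
  `b(n) = χ(n)(ϰ₁(n)1_{[P^{1/2},P₁)}(n) − ϰ₁₂(n)1_{(P^{0.5}η₋,P₁η₊)}(n))` (admissible for (7.2) with
  `B = 2`), Lemma 8.1 + Proposition 7.1 at `(𝐛, \bar 𝐛)` (weights `𝔠*ω` real `≥ 0` at the zeros by
  Lemma 2.3, Prop. 2.2 (i); `𝔞 ≫ 1` by the tree's `frakALowerBound_holds`) reduce (12.6)
  (`Typed.Sec12A.Eq126 c′`) to the single estimate
  **`S_j(𝐛, \bar 𝐛) = o(α𝔞)` (`j = 1,2,3`)** — typed inline as the hypothesis `hS`. This is the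
  computation the manuscript leaves unwritten (a §10-type range evaluation of `S_j` for the
  coefficients `ϰ₁ − ϰ₁₂`, where u004–u008 would enter); the kernel certifies it is SUFFICIENT.

Nothing here asserts (12.6), or anything about Theorems 1–2 / Landau–Siegel zeros.
[cite: Zhang2022LandauSiegel, §12 (12.6) p.67, tex L3415]
-/

noncomputable section

open Complex Real ComplexConjugate

namespace Literature.NumberTheory.LFunctions.Zhang2022.Typed.Sec12A

open Skeleton Section11E2MeanSquare

/-- **`Ded126 c′` as typed is vacuously true** (its antecedent `FraktDoubleSum` — u008 as printed —
is refuted: `not_fraktDoubleSum`). NOT a proof of (12.6). [cite: Zhang2022LandauSiegel, §12 p.67] -/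
theorem ded126_vacuous (c' : ℝ) : Ded126 c' :=
  fun _ _ _ _ h => absurd h not_fraktDoubleSum

/-- `Ded126 c′` AS TYPED holds for every `c′` (VACUOUSLY: its antecedent `FraktDoubleSum` is refuted in-tree; this is NOT a proof of the manuscript's (12.6)) — `_holds` alias of `ded126_vacuous` above (appended
2026-08-28, D-0026 bookkeeping: the proof term is the existing theorem of this file; no
statement, definition or attribute is edited; no new named fact).
[cite: Zhang2022LandauSiegel, §12 p.67] -/
theorem Ded126_holds (c' : ℝ) : Ded126 c' :=
  ded126_vacuous c'

/-! ## Sizes for `𝓛 ≥ 2` -/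

/-- For `D ≥ ⌈e^M⌉`, `𝓛 = log D ≥ M`. [cite: Zhang2022LandauSiegel, §2 p.4] -/
private theorem le_ell_of_ceil_exp_le {M : ℝ} {D : ℕ} (hD : ⌈Real.exp M⌉₊ ≤ D) : M ≤ ell D := by
  have h : Real.exp M ≤ D := le_trans (Nat.le_ceil _) (by exact_mod_cast hD)
  exact (Real.le_log_iff_exp_le (lt_of_lt_of_le (Real.exp_pos _) h)).mpr h

/-- `P₁η₊ ≤ PT⁻²` for `𝓛 ≥ 2` (`0.504𝓛⁹ + 𝓛⁻¹⁰ ≤ 𝓛⁹ − 2𝓛^{1.1}`): the support of `H̃₁₅` lies below the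
truncation `⌈PT⁻²⌉` of `A(𝐚;s,ψ)`. [cite: Zhang2022LandauSiegel, §7 (7.2), §12 p.66] -/
private theorem P1_eta_le_P_div_T_sq {D : ℕ} (hL : 2 ≤ ell D) :
    Skeleton.P1 D * etaPM D 1 ≤ bigP D / bigT D ^ 2 := by
  have h1 : (1 : ℝ) ≤ ell D := by linarith
  have hℓ0 : 0 < ell D := by linarith
  have h11 : ell D ^ (1.1 : ℝ) ≤ ell D ^ (2 : ℝ) :=
    Real.rpow_le_rpow_of_exponent_le h1 (by norm_num)
  rw [Real.rpow_two] at h11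
  have hx : (ell D ^ 10)⁻¹ ≤ 1 := by
    apply inv_le_one_of_one_le₀; exact one_le_pow₀ h1
  rw [Skeleton.P1, bigP, bigT, etaPM, ← Real.exp_mul, ← Real.exp_add, ← Real.exp_nat_mul,
    ← Real.exp_sub, Real.exp_le_exp]
  push_cast
  nlinarith [pow_le_pow_left₀ (by linarith : (0 : ℝ) ≤ 2) hL 7, pow_pos hℓ0 2,
    mul_le_mul_of_nonneg_left (pow_le_pow_left₀ (by linarith : (0 : ℝ) ≤ 2) hL 7)
      (pow_nonneg hℓ0.le 2),
    show ell D ^ 9 = ell D ^ 2 * ell D ^ 7 by ring]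

/-- `‖ϰ₁₂(n)‖ ≤ 1` (`|∫_{0.5}^{0.504}(g − g)| ≤ 0.004`, `|(P₁/n)^{β₆}| = 1`).
[cite: Zhang2022LandauSiegel, §12 p.66] -/
private theorem norm_vk12_le_one {D : ℕ} (hL : 2 ≤ ell D) {n : ℕ} (hn : 1 ≤ n) : ‖vk12 D n‖ ≤ 1 := by
  have hℓ : 0 < ell D := by linarith
  have hP1 : 0 < Skeleton.P1 D := Real.rpow_pos_of_pos (Real.exp_pos _) _
  have hn0 : (0 : ℝ) < n := by exact_mod_cast hn
  rw [norm_vk12_eq hP1 hn0]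
  have hint : |∫ z in (0.5 : ℝ)..0.504, (gW D (bigP D ^ z / n) - gW D (bigP D ^ (0.5 : ℝ) / n))| ≤
      1 * |(0.504 : ℝ) - 0.5| := by
    rw [← Real.norm_eq_abs]
    exact intervalIntegral.norm_integral_le_of_norm_le_const fun z _ => by
      rw [Real.norm_eq_abs]; exact abs_gW_sub_gW_le_one hℓ _ _
  rw [abs_of_pos (by norm_num : (0 : ℝ) < 0.504 - 0.5)] at hint
  have : (0 : ℝ) ≤ |∫ z in (0.5 : ℝ)..0.504,
      (gW D (bigP D ^ z / n) - gW D (bigP D ^ (0.5 : ℝ) / n))| := abs_nonneg _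
  nlinarith

/-! ## The reduction -/

/-- **(12.6) from Lemma 8.1, Proposition 7.1 and the one unprinted estimate `S_j(𝐛,\bar𝐛) = o(α𝔞)`**
for the coefficient sequence `𝐛` of `H₁₅ − H̃₁₅` (typed inline: `b(n) = χ(n)ϰ₁(n)` on
`P^{1/2} ≤ n < P₁` minus `χ(n)ϰ₁₂(n)` on `P^{0.5}η₋ < n < P₁η₊`, over the index sets of the banked
`Skeleton.H15` and `Typed.Sec12A.Htilde15`). Silent inputs made explicit: Lemma 2.3 and Prop. 2.2 (i)
(`𝔠*(ρ,ψ) ≥ 0` real, `ω(ρ) > 0`, `Re ρ = ½`), `𝔞 ≫ 1` (`frakALowerBound_holds`). The hypothesis `hS`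
is EXACTLY what the manuscript's "These bounds together with (8.25) and (8.26) imply (12.6)" (p.67,
tex L3415) leaves unwritten; this theorem certifies it suffices.
[cite: Zhang2022LandauSiegel, §12 (12.6) p.67; §8 Lemma 8.1; §7 Prop. 7.1] -/
theorem eq126_of_sj_small (c' : ℝ) (h22 : Prop22i) (h23 : Lemma23 c') (h81 : Lemma81 c')
    (h71 : Prop71 c')
    (hS : ∀ ε : ℝ, 0 < ε → ForAllLarge fun D _ χ => AssumptionA D χ →
      ∀ j ∈ ({1, 2, 3} : Finset ℕ),
        ‖Sj c' D j
            (fun n : ℕ =>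
              (if n ∈ (Finset.Ico 1 ⌈Skeleton.P1 D⌉₊).filter
                    (fun n : ℕ => ¬ (n : ℝ) < bigP D ^ (1 / 2 : ℝ))
                then χ (n : ZMod D) * vk1 D n else 0) -
              (if n ∈ (Finset.Ico 1 ⌈Skeleton.P1 D * etaPM D 1⌉₊).filter
                    (fun n : ℕ => bigP D ^ (0.5 : ℝ) * etaPM D (-1) < n ∧
                      (n : ℝ) < Skeleton.P1 D * etaPM D 1)
                then χ (n : ZMod D) * vk12 D n else 0))
            (fun n : ℕ => conj (
              (if n ∈ (Finset.Ico 1 ⌈Skeleton.P1 D⌉₊).filter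
                    (fun n : ℕ => ¬ (n : ℝ) < bigP D ^ (1 / 2 : ℝ))
                then χ (n : ZMod D) * vk1 D n else 0) -
              (if n ∈ (Finset.Ico 1 ⌈Skeleton.P1 D * etaPM D 1⌉₊).filter
                    (fun n : ℕ => bigP D ^ (0.5 : ℝ) * etaPM D (-1) < n ∧
                      (n : ℝ) < Skeleton.P1 D * etaPM D 1)
                then χ (n : ZMod D) * vk12 D n else 0)))‖ ≤
          ε * alpha D * frakA χ) :
    Eq126 c' := by
  intro ε hε
  obtain ⟨a₀, ha₀, hA⟩ := frakALowerBound_holds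
  -- the three error budgets
  obtain ⟨C, D₁, h71'⟩ := h71 2 (ε * a₀ / 8) (by positivity)
  have hε₃ : 0 < ε / (8 * (4 + 10 * |C| + 1)) := by positivity
  obtain ⟨D₀, h⟩ := ((((h22.and h23).and hA).and (h81 2 (ε * a₀ / 8) (by positivity))).and
    (hS _ hε₃))
  refine ⟨max (max D₀ D₁) ⌈Real.exp 2⌉₊, fun D _ χ hD hq hp hAss => ?_⟩
  have hD₀ : D₀ ≤ D := le_trans (le_trans (le_max_left _ _) (le_max_left _ _)) hD
  have hD₁ : D₁ ≤ D := le_trans (le_trans (le_max_right _ _) (le_max_left _ _)) hD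
  have hL : 2 ≤ ell D := le_ell_of_ceil_exp_le (le_trans (le_max_right _ _) hD)
  have hlog : 2 ≤ Real.log D := hL
  have hℓ0 : 0 < ell D := by linarith
  have hD3 : 3 ≤ D := by
    have h3 : (3 : ℝ) ≤ Real.exp 2 := by have := Real.add_one_le_exp (2 : ℝ); linarith
    have : (3 : ℝ) ≤ (D : ℝ) :=
      le_trans (le_trans h3 (Nat.le_ceil _)) (by exact_mod_cast le_trans (le_max_right _ _) hD)
    exact_mod_cast this
  obtain ⟨⟨⟨⟨h22', h23'⟩, hA'⟩, h81'⟩, hS'⟩ := h D χ hD₀ hq hp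
  have h71D := h71' D χ hD₁ hq hp hAss
  have ha : a₀ ≤ frakA χ := hA' hAss
  -- the sequence
  set S15 : Finset ℕ := (Finset.Ico 1 ⌈Skeleton.P1 D⌉₊).filter
    (fun n : ℕ => ¬ (n : ℝ) < bigP D ^ (1 / 2 : ℝ)) with hS15
  set St : Finset ℕ := (Finset.Ico 1 ⌈Skeleton.P1 D * etaPM D 1⌉₊).filter
    (fun n : ℕ => bigP D ^ (0.5 : ℝ) * etaPM D (-1) < n ∧ (n : ℝ) < Skeleton.P1 D * etaPM D 1)
    with hSt
  set b : ℕ → ℂ := fun n =>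
    (if n ∈ S15 then χ (n : ZMod D) * vk1 D n else 0) -
      (if n ∈ St then χ (n : ZMod D) * vk12 D n else 0) with hb
  set bb : ℕ → ℂ := fun n => conj (b n) with hbb
  have hSj := hS' hAss
  -- supports
  have hNs : ⌈Skeleton.P1 D⌉₊ ≤ Nsupp D := ceil_P1_le_Nsupp D hlog
  have hNt : ⌈Skeleton.P1 D * etaPM D 1⌉₊ ≤ Nsupp D := Nat.ceil_mono (P1_eta_le_P_div_T_sq hL)
  have hS15sub : S15 ⊆ Finset.range (Nsupp D) := by
    intro n hn
    rw [hS15, Finset.mem_filter, Finset.mem_Ico] at hn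
    exact Finset.mem_range.mpr (lt_of_lt_of_le hn.1.2 hNs)
  have hStsub : St ⊆ Finset.range (Nsupp D) := by
    intro n hn
    rw [hSt, Finset.mem_filter, Finset.mem_Ico] at hn
    exact Finset.mem_range.mpr (lt_of_lt_of_le hn.1.2 hNt)
  -- admissibility (7.2) with `B = 2`
  have hP1one : 1 < Skeleton.P1 D := by
    rw [Skeleton.P1, bigP, ← Real.exp_mul]
    exact Real.one_lt_exp_iff.mpr (by positivity)
  have hadm : Adm72 D 2 b := by
    refine ⟨fun n => ?_, fun n hn => ?_⟩
    · rw [hb]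
      refine le_trans (norm_sub_le _ _) ?_
      have h1 : ‖(if n ∈ S15 then χ (n : ZMod D) * vk1 D n else 0)‖ ≤ 1 := by
        split_ifs with hn
        · have hn1 : 1 ≤ n := (Finset.mem_Ico.mp (Finset.mem_filter.mp hn).1).1
          rw [norm_mul]
          exact mul_le_one₀ (DirichletCharacter.norm_le_one _ _) (norm_nonneg _)
            (norm_vk1_le_one hP1one hn1)
        · rw [norm_zero]; exact zero_le_one
      have h2 : ‖(if n ∈ St then χ (n : ZMod D) * vk12 D n else 0)‖ ≤ 1 := by
        split_ifs with hn
        · have hn1 : 1 ≤ n := (Finset.mem_Ico.mp (Finset.mem_filter.mp hn).1).1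
          rw [norm_mul]
          exact mul_le_one₀ (DirichletCharacter.norm_le_one _ _) (norm_nonneg _)
            (norm_vk12_le_one hL hn1)
        · rw [norm_zero]; exact zero_le_one
      linarith
    · have hn1 : n ∉ S15 := by
        intro h
        have h' := (Finset.mem_Ico.mp (Finset.mem_filter.mp h).1).2
        have : (n : ℝ) < Skeleton.P1 D := Nat.lt_ceil.mp h'
        linarith [P1_lt_P_div_T_sq D hlog]
      have hn2 : n ∉ St := by
        intro h
        have h' := (Finset.mem_filter.mp h).2.2
        linarith [P1_eta_le_P_div_T_sq hL]
      simp only [hb, hn1, hn2, if_false, sub_zero]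
  have hbdm : Adm72 D 2 bb := adm72_conj hadm
  have hbba : (fun n => conj (bb n)) = b := by funext n; simp [hbb]
  -- `H₁₅ − H̃₁₅ = A(𝐛;·,ψ)`
  have hH : ∀ (x : Chr D) (s : ℂ), H15 χ x s - Htilde15 χ x s = Apoly x b s := by
    intro x s
    rw [Apoly, Lemma81.dirPoly_def]
    have e : ∀ n ∈ Finset.range (Nsupp D), b n * x.ψ n * (n : ℂ) ^ (-s) =
        (if n ∈ S15 then vk1 D n * pc χ x n * (n : ℂ) ^ (-s) else 0) -
          (if n ∈ St then vk12 D n * pc χ x n * (n : ℂ) ^ (-s) else 0) := by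
      intro n _
      by_cases h1 : n ∈ S15 <;> by_cases h2 : n ∈ St <;>
        simp only [hb, h1, h2, if_true, if_false, pc] <;> ring
    rw [Finset.sum_congr rfl e, Finset.sum_sub_distrib, Finset.sum_ite_mem, Finset.sum_ite_mem,
      Finset.inter_eq_right.mpr hS15sub, Finset.inter_eq_right.mpr hStsub]
    rfl
  -- pointwise facts at the zeros
  have mem : ∀ i ∈ idx χ, i.1 ∈ PsiOne χ ∧ i.2 ∈ zeroSet D i.1 := by
    intro i hi
    rw [idx, Finset.mem_sigma] at hi
    exact ⟨mem_of_mem_finsetOf hi.1, mem_of_mem_finsetOf hi.2⟩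
  have hre : ∀ i ∈ idx χ, i.2.re = 1 / 2 := fun i hi =>
    h22' i.1 (mem i hi).1 i.2 (mem_prodZeroSetOmega_of_mem_zeroSet χ (mem i hi).2)
  have hcIm : ∀ i ∈ idx χ, (cstar c' D i.1 i.2).im = 0 := fun i hi =>
    (h23' i.1 (mem i hi).1 i.2 (mem i hi).2).1
  have hωIm : ∀ i ∈ idx χ, (omegaW D i.2).im = 0 := fun i hi => (omegaW_re_pos hD3 (hre i hi)).2
  -- Lemma 8.1 and Prop. 7.1 at `(b, bb)`
  have k81 := h81' hAss b bb hadm hbdm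
  rw [hbba] at k81
  have k71 := h71D b bb hadm hbdm
  -- sizes from `hS`
  have hS1 := hSj 1 (by simp)
  have hS2 := hSj 2 (by simp)
  have hS3 := hSj 3 (by simp)
  have hP : 0 ≤ frakP D := frakP_nonneg D
  have hfa : 0 ≤ frakA χ := le_trans ha₀.le ha
  have hα : alpha D = π / ell D ^ 9 := by rw [alpha, bigP, Real.log_exp]
  have hα0 : 0 < alpha D := by rw [hα]; positivity
  set e3 : ℝ := ε / (8 * (4 + 10 * |C| + 1)) with he3
  have hmain : ‖mainMV c' D b bb‖ ≤ 4 * e3 * frakA χ * frakP D := by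
    rw [mainMV, norm_mul, norm_mul, Complex.norm_real, Real.norm_of_nonneg hP, norm_inv,
      Complex.norm_real, Real.norm_of_nonneg hα0.le]
    have hsum : ‖1 / 2 * Sj c' D 1 b bb + 2 * Sj c' D 2 b bb + 3 / 2 * Sj c' D 3 b bb‖ ≤
        4 * (e3 * alpha D * frakA χ) := by
      calc _ ≤ ‖1 / 2 * Sj c' D 1 b bb‖ + ‖2 * Sj c' D 2 b bb‖ + ‖3 / 2 * Sj c' D 3 b bb‖ :=
            norm_add₃_le
        _ = 1 / 2 * ‖Sj c' D 1 b bb‖ + 2 * ‖Sj c' D 2 b bb‖ + 3 / 2 * ‖Sj c' D 3 b bb‖ := by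
            rw [norm_mul, norm_mul, norm_mul]; norm_num
        _ ≤ 1 / 2 * (e3 * alpha D * frakA χ) + 2 * (e3 * alpha D * frakA χ) +
              3 / 2 * (e3 * alpha D * frakA χ) := by gcongr
        _ = 4 * (e3 * alpha D * frakA χ) := by ring
    calc (alpha D)⁻¹ * ‖1 / 2 * Sj c' D 1 b bb + 2 * Sj c' D 2 b bb + 3 / 2 * Sj c' D 3 b bb‖ *
          frakP D ≤ (alpha D)⁻¹ * (4 * (e3 * alpha D * frakA χ)) * frakP D := by gcongr
      _ = 4 * e3 * frakA χ * frakP D := by field_simp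
  have hE : Ecal c' D b bb ≤ 3 * π * e3 * frakA χ * frakP D := by
    rw [Ecal]
    have hαL : alpha D * ell D ^ 2 ≤ π := by
      rw [hα, div_mul_eq_mul_div, div_le_iff₀ (by positivity)]
      have : ell D ^ 2 ≤ ell D ^ 9 := pow_le_pow_right₀ (by linarith) (by norm_num)
      nlinarith [Real.pi_pos]
    calc frakP D * ell D ^ 2 * (‖Sj c' D 1 b bb‖ + ‖Sj c' D 2 b bb‖ + ‖Sj c' D 3 b bb‖)
        ≤ frakP D * ell D ^ 2 * (e3 * alpha D * frakA χ + e3 * alpha D * frakA χ +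
            e3 * alpha D * frakA χ) := by gcongr
      _ = 3 * e3 * (alpha D * ell D ^ 2) * frakA χ * frakP D := by ring
      _ ≤ 3 * e3 * π * frakA χ * frakP D := by gcongr
      _ = 3 * π * e3 * frakA χ * frakP D := by ring
  have hΘ : ‖Theta1 c' χ b bb‖ ≤ (4 + 10 * |C|) * e3 * frakA χ * frakP D + ε * a₀ / 8 * frakP D := by
    have h1 : ‖Theta1 c' χ b bb‖ ≤ ‖mainMV c' D b bb‖ + ‖Theta1 c' χ b bb - mainMV c' D b bb‖ :=
      norm_le_insert' _ _
    have hE0 : 0 ≤ Ecal c' D b bb := by rw [Ecal]; positivity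
    have h2 : C * Ecal c' D b bb ≤ |C| * (3 * π * e3 * frakA χ * frakP D) :=
      le_trans (mul_le_mul_of_nonneg_right (le_abs_self C) hE0)
        (mul_le_mul_of_nonneg_left hE (abs_nonneg C))
    have he30 : 0 ≤ e3 := hε₃.le
    have h3 : |C| * (3 * π * e3 * frakA χ * frakP D) ≤ 10 * |C| * e3 * frakA χ * frakP D := by
      have hq : 0 ≤ e3 * frakA χ * frakP D := mul_nonneg (mul_nonneg he30 hfa) hP
      have : 3 * π * e3 * frakA χ * frakP D ≤ 10 * (e3 * frakA χ * frakP D) := by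
        have hπ : 3 * π ≤ 10 := by linarith [Real.pi_lt_d2]
        calc 3 * π * e3 * frakA χ * frakP D = (3 * π) * (e3 * frakA χ * frakP D) := by ring
          _ ≤ 10 * (e3 * frakA χ * frakP D) := mul_le_mul_of_nonneg_right hπ hq
      calc |C| * (3 * π * e3 * frakA χ * frakP D) ≤ |C| * (10 * (e3 * frakA χ * frakP D)) :=
            mul_le_mul_of_nonneg_left this (abs_nonneg C)
        _ = 10 * |C| * e3 * frakA χ * frakP D := by ring
    linarith
  -- the left side of Lemma 8.1 is the mean square `ms126`
  have hlhs : lhs81 c' χ b bb = ∑ i ∈ idx χ, cstar c' D i.1 i.2 *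
      ((‖Apoly i.1 b i.2‖ ^ 2 : ℝ) : ℂ) * omegaW D i.2 := lhs81_conj_eq c' χ b hre
  have hre_sum : (lhs81 c' χ b bb).re = ms126 c' χ := by
    rw [hlhs, Complex.re_sum, ms126]
    refine Finset.sum_congr rfl fun i hi => ?_
    rw [Complex.mul_re, Complex.mul_re, Complex.mul_im, hcIm i hi, hωIm i hi, Complex.ofReal_re,
      Complex.ofReal_im, ← hH i.1 i.2]
    ring
  have hbound : ‖lhs81 c' χ b bb‖ ≤ 2 * ‖Theta1 c' χ b bb‖ + ε * a₀ / 8 * frakP D := by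
    calc ‖lhs81 c' χ b bb‖ ≤ ‖Theta1 c' χ b bb + conj (Theta1 c' χ b bb)‖ +
          ‖lhs81 c' χ b bb - (Theta1 c' χ b bb + conj (Theta1 c' χ b bb))‖ := norm_le_insert' _ _
      _ ≤ (‖Theta1 c' χ b bb‖ + ‖Theta1 c' χ b bb‖) + ε * a₀ / 8 * frakP D := by
          refine add_le_add (le_trans (norm_add_le _ _) ?_) k81
          rw [RCLike.norm_conj]
      _ = 2 * ‖Theta1 c' χ b bb‖ + ε * a₀ / 8 * frakP D := by ring
  calc |ms126 c' χ| = |(lhs81 c' χ b bb).re| := by rw [hre_sum]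
    _ ≤ ‖lhs81 c' χ b bb‖ := Complex.abs_re_le_norm _
    _ ≤ 2 * ((4 + 10 * |C|) * e3 * frakA χ * frakP D + ε * a₀ / 8 * frakP D) +
          ε * a₀ / 8 * frakP D := by linarith
    _ = (2 * (4 + 10 * |C|) * e3) * (frakA χ * frakP D) + (3 * ε / 8) * (a₀ * frakP D) := by ring
    _ ≤ (ε / 4) * (frakA χ * frakP D) + (3 * ε / 8) * (frakA χ * frakP D) := by
        have h1 : 2 * (4 + 10 * |C|) * e3 ≤ ε / 4 := by
          rw [he3, show 2 * (4 + 10 * |C|) * (ε / (8 * (4 + 10 * |C| + 1))) =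
            (ε / 4) * ((4 + 10 * |C|) / (4 + 10 * |C| + 1)) by field_simp; ring]
          have : (4 + 10 * |C|) / (4 + 10 * |C| + 1) ≤ 1 := by
            rw [div_le_one (by positivity)]; linarith
          nlinarith
        have h2 : a₀ * frakP D ≤ frakA χ * frakP D := mul_le_mul_of_nonneg_right ha hP
        nlinarith [mul_nonneg hfa hP]
    _ ≤ ε * frakA χ * frakP D := by nlinarith [mul_nonneg hfa hP]

end Literature.NumberTheory.LFunctions.Zhang2022.Typed.Sec12A

end
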